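import Literature.NumberTheory.LFunctions.WeilExplicit
import Mathlib.Analysis.Calculus.BumpFunction.InnerProduct
import Mathlib.Analysis.Normed.Group.Tannery
import Mathlib.NumberTheory.LSeries.Dirichlet
import HarnessLib

/-!
# The prime term of the Weil functional under cut-offs

Stub `stub_primeLimit` of the line "Sketch (heat cone)" for the crux
`Summit.RiemannHypothesis.RiemannHypothesis.Theses.RuelleBand.ExactFirstBand`: for a smooth bump
`χ` (`χ = 1` near `0`, `0 ≤ χ ≤ 1`) and a continuous `g : ℝ → ℂ` with `‖g t‖ ≤ C e^{-|t|}`, the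
prime term `Σₙ Λ(n) n^{-1/2} (g_R(log n) + g_R(-log n))` of the cut-off `g_R = χ(·/R) · g` tends,
as `R → ∞`, to the prime term of `g`.  Proof: dominated convergence for series over `ℕ`
(`tendsto_tsum_of_dominated_convergence`) with dominator `Λ(n) n^{-1/2} · 2C e^{-|log n|}`
(`|χ| ≤ 1`); since `e^{-|log n|} = 1/n` for `n ≥ 1` this is `2C · Λ(n) n^{-3/2}`, summable by
`LSeriesSummable` of `Λ` at `s = 3/2`; termwise `χ(±log n / R) → χ(0) = 1`.
-/

set_option linter.dupNamespace false

noncomputable section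

open Complex MeasureTheory Filter Set
open scoped Topology ArithmeticFunction.vonMangoldt

namespace Summit.RiemannHypothesis.RiemannHypothesis.Theorems.RuelleBandExactFirstBand

open Literature.NumberTheory.LFunctions

/-- The coefficient `Λ(n) n^{-1/2}` (cast to `ℂ`) has norm `Λ(n) / √n`. -/
theorem stub_primeLimit_norm_coeff (n : ℕ) :
    ‖((Λ n : ℝ) : ℂ) / (Real.sqrt n : ℂ)‖ = Λ n / Real.sqrt n := by
  rw [norm_div, Complex.norm_of_nonneg ArithmeticFunction.vonMangoldt_nonneg,
    Complex.norm_of_nonneg (Real.sqrt_nonneg _)]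

/-- Summability of the dominator `Λ(n) n^{-1/2} · 2C e^{-|log n|} = 2C Λ(n) n^{-3/2}` (`n ≥ 1`; the
`n = 0` term vanishes), from the absolute convergence of the `L`-series of `Λ` at `s = 3/2`. -/
theorem stub_primeLimit_summable (C : ℝ) :
    Summable fun n : ℕ => Λ n / Real.sqrt n * (2 * (C * Real.exp (-|Real.log n|))) := by
  have h := ArithmeticFunction.LSeriesSummable_vonMangoldt (s := ((3 / 2 : ℝ) : ℂ))
    (by rw [Complex.ofReal_re]; norm_num)
  rw [LSeriesSummable, ← summable_norm_iff] at h
  refine (h.mul_left (2 * C)).congr fun n => ?_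
  simp only [LSeries.norm_term_eq, Complex.ofReal_re]
  rcases eq_or_ne n 0 with rfl | hn
  · simp
  · have hn' : (0 : ℝ) < n := Nat.cast_pos.2 (Nat.pos_of_ne_zero hn)
    have hsq : 0 < Real.sqrt n := Real.sqrt_pos.2 hn'
    rw [if_neg hn, Complex.norm_of_nonneg ArithmeticFunction.vonMangoldt_nonneg,
      abs_of_nonneg (Real.log_natCast_nonneg n), Real.exp_neg, Real.exp_log hn',
      show (3 / 2 : ℝ) = 1 + 1 / 2 by norm_num, Real.rpow_add hn', Real.rpow_one,
      ← Real.sqrt_eq_rpow]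
    field_simp

/-- For a bump `χ` centred at `0` and any `a : ℝ`, `χ(a / R) → 1` (in `ℂ`) as `R → ∞`
(`a / R → 0` and `χ = 1` on the closed ball of radius `χ.rIn`). -/
theorem stub_primeLimit_tendsto_bump (χ : ContDiffBump (0 : ℝ)) (a : ℝ) :
    Tendsto (fun R : ℝ => ((χ (a / R) : ℝ) : ℂ)) atTop (𝓝 1) := by
  have h0 : χ 0 = 1 := χ.one_of_mem_closedBall (Metric.mem_closedBall_self χ.rIn_pos.le)
  have h1 : Tendsto (fun R : ℝ => a / R) atTop (𝓝 0) := tendsto_const_nhds.div_atTop tendsto_id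
  have h2 : Tendsto (fun R : ℝ => χ (a / R)) atTop (𝓝 1) := by
    have := (χ.continuous.tendsto 0).comp h1
    rwa [h0] at this
  have h3 : Tendsto (fun R : ℝ => ((χ (a / R) : ℝ) : ℂ)) atTop (𝓝 ((1 : ℝ) : ℂ)) :=
    (Complex.continuous_ofReal.tendsto 1).comp h2
  rwa [Complex.ofReal_one] at h3

/-- For a bump `χ` centred at `0`, `‖χ x‖ ≤ 1` (in `ℂ`). -/
theorem stub_primeLimit_norm_bump_le (χ : ContDiffBump (0 : ℝ)) (x : ℝ) :
    ‖((χ x : ℝ) : ℂ)‖ ≤ 1 := by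
  rw [Complex.norm_of_nonneg χ.nonneg]
  exact χ.le_one

/-- **The prime sum under cut-offs.** For continuous `g` with `‖g(t)‖ ≤ Ce^{-|t|}` the prime
term `Σ Λ(n) n^{-1/2}(g_R(log n) + g_R(-log n))` of `g_R = χ(·/R)·g` tends to that of `g` as
`R → ∞`: dominated convergence over `ℕ` (`tendsto_tsum_of_dominated_convergence`), dominator
`Λ(n) n^{-1/2} · 2C e^{-|log n|}` (`|χ| ≤ 1`), summable (`stub_primeLimit_summable`), termwise
`χ(±log n/R) → χ(0) = 1` (`stub_primeLimit_tendsto_bump`). -/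
theorem stub_primeLimit :
    ∀ (χ : ContDiffBump (0 : ℝ)) (g : ℝ → ℂ), Continuous g →
      (∃ C : ℝ, ∀ t : ℝ, ‖g t‖ ≤ C * Real.exp (-|t|)) →
      Tendsto (fun R : ℝ => weilPrimeTerm (fun t : ℝ => (χ (t / R) : ℂ) * g t)) atTop
        (𝓝 (weilPrimeTerm g)) := by
  rintro χ g - ⟨C, hC⟩
  simp only [weilPrimeTerm]
  refine tendsto_tsum_of_dominated_convergence (stub_primeLimit_summable C) (fun n => ?_)
    (Eventually.of_forall fun R n => ?_)
  · have h := ((stub_primeLimit_tendsto_bump χ (Real.log n)).mul_const (g (Real.log n))).add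
      ((stub_primeLimit_tendsto_bump χ (-Real.log n)).mul_const (g (-Real.log n)))
    rw [one_mul, one_mul] at h
    exact h.const_mul _
  · rw [norm_mul, stub_primeLimit_norm_coeff]
    refine mul_le_mul_of_nonneg_left ?_
      (div_nonneg ArithmeticFunction.vonMangoldt_nonneg (Real.sqrt_nonneg _))
    have h1 := hC (Real.log n)
    have h2 := hC (-Real.log n)
    rw [abs_neg] at h2
    calc ‖(χ (Real.log n / R) : ℂ) * g (Real.log n) + (χ (-Real.log n / R) : ℂ) * g (-Real.log n)‖
        ≤ ‖(χ (Real.log n / R) : ℂ) * g (Real.log n)‖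
            + ‖(χ (-Real.log n / R) : ℂ) * g (-Real.log n)‖ := norm_add_le _ _
      _ ≤ ‖g (Real.log n)‖ + ‖g (-Real.log n)‖ := by
          rw [norm_mul, norm_mul]
          exact add_le_add
            (mul_le_of_le_one_left (norm_nonneg _) (stub_primeLimit_norm_bump_le χ _))
            (mul_le_of_le_one_left (norm_nonneg _) (stub_primeLimit_norm_bump_le χ _))
      _ ≤ C * Real.exp (-|Real.log n|) + C * Real.exp (-|Real.log n|) := add_le_add h1 h2
      _ = 2 * (C * Real.exp (-|Real.log n|)) := by ring

end Summit.RiemannHypothesis.RiemannHypothesis.Theorems.RuelleBandExactFirstBand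

end
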